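import Summits.ResolutionOfSingularities.ResolutionOfSingularities.Theorems.FrobeniusLadderFInjectiveMacaulayficationX2Cubic4Specimen
import Summits.ResolutionOfSingularities.ResolutionOfSingularities.Theorems.FrobeniusLadderFInjectiveMacaulayficationCensusBedsWeaklyNondegenerate
import HarnessLib

/-!
# THE DIAGONAL DOUBLE-POINT FAMILY `z² + x^a + y^a + u^a + t^a` (`a` ODD, `a ≥ 3`; `2, a ≠ 0` in `k`): SPECIMEN PACKAGE — prime, convenient, weakly non-degenerate, no variable
# vanishes, vertex singular, regular off the vertex
# (crux `FInjectiveMacaulayfication` stmt-ResolutionOfSingularities-15315, chain w45a; res-L1-w45a-plan-1 RULING R22.10 (b) «the DIAGONAL FAMILY CONDITIONAL ROW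
# `diagonalRow_of_F108Consumable : F108Consumable k 5 → ∀ a odd ≥ 5 with (2:k) ≠ 0, (a:k) ≠ 0 → the two-sided census row at the origin of V(X₄² + X₀^a + X₁^a + X₂^a + X₃^a)`
# — prime by T² + c, isolated by the Jacobian, convenient, WND with single-monomial Tjurina partials»; input side, symbolic in `a`; seat res-L1-w45a-stub-1 g13; template =
# ✓ `B9Specimen` (`a = 9`) with the exponent made symbolic)

[OURS · L1 W4.5a] Support file (`--supports stmt-ResolutionOfSingularities-15315 --as helper`); def-free, UNCONDITIONAL; replaces the role of NO printed item; NOT a statement of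
the manuscript; AI-written (AI review is weaker than expert review).

Letters: `X 0..X 3 = x,y,u,t`, `X 4 = z`, `f = X4² + X0^a + X1^a + X2^a + X3^a`, `v` = the origin. Hypotheses as needed: `Odd a` (primality: `c(1,−1,0,0) = 0`), `a ≠ 0` /
`2 ≤ a`, `(2 : k) ≠ 0`, `(a : k) ≠ 0`.
* §1 `pderiv_four_f` (`2z`), `pderiv_pow_f` (`a·X_j^{a−1}`), `constantCoeff_f`, ★ `prime_f` (`T² + C(c)`, `c = x^a+y^a+u^a+t^a`, Eisenstein-type at `(1,−1,0,0)`: `c = 0` as `a` is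
  odd, `∂c/∂x = a ≠ 0`; ✓ `irreducible_X_pow_add_C_mul_X_add_C`), ★ `regular_off_vertex` (Jacobian), `f_not_mem_span_X`, `mk_X_ne_zero`, `vertex_not_mem_regularLocus`.
* §2 `eq_monomials` / `mem_support_f` (the support is the five pure powers), ★ `convenient_f` (every variable occurs as a pure power: the CONVENIENT hypothesis of
  ✓ `F108ClassRow.F108Consumable`), ★ `weaklyNondegenerate_f` — weakly (Tjurina) non-degenerate along EVERY positive weight by res-L1-w45a-stub-3ʼs good-support criterion
  ✓ `CensusBedsWeaklyNondegenerate.weaklyNondegenerate_of_good_support` (`β₀ = 2e_z`; good exponents `a·e_j`, `j < 4`, private variables, `a ≠ 0` in `k`).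
The floor side and the conditional row are the sequel `…DiagonalSqRowOfF108`. [folklore mathematics, OURS as a certificate; cite: Hartshorne1977, I Thm. 5.1;
BoubakriGreuelMarkwig2010, §3 (p. 10)]
-/

-- single-problem summit: the doubled namespace component is forced
set_option linter.dupNamespace false

noncomputable section

namespace Summit.ResolutionOfSingularities.ResolutionOfSingularities.Theorems.FInjectiveMacaulayfication.DiagonalSqSpecimen

open CategoryTheory CategoryTheory.Limits AlgebraicGeometry TopologicalSpace IsLocalRing MvPolynomial
open Literature.AlgebraicGeometry.Resolution Literature.AlgebraicGeometry.Resolution.BoubakriGreuelMarkwig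
open Summit.ResolutionOfSingularities.ResolutionOfSingularities.Theorems.FInjectiveMacaulayfication
open SliceableCentre GermForm GermOfGlobalBlowup FCentreE1RungZero X2Cubic4Specimen CensusBedsWeaklyNondegenerate

/-! ## §1 Derivatives, primality, regularity off the vertex -/

/-- `∂f/∂z = 2z`. [folklore] -/
theorem pderiv_four_f (k : Type) [Field k] (a : ℕ) (f : MvPolynomial (Fin 5) k)
    (hf : f = X 4 ^ 2 + X 0 ^ a + X 1 ^ a + X 2 ^ a + X 3 ^ a) : pderiv 4 f = 2 * X 4 := by
  rw [hf]
  simp only [map_add, pderiv_pow, pderiv_X_self, pderiv_X_of_ne (show (0 : Fin 5) ≠ 4 by decide),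
    pderiv_X_of_ne (show (1 : Fin 5) ≠ 4 by decide), pderiv_X_of_ne (show (2 : Fin 5) ≠ 4 by decide),
    pderiv_X_of_ne (show (3 : Fin 5) ≠ 4 by decide), mul_zero, mul_one, add_zero]
  push_cast
  ring

/-- `∂f/∂X_j = a·X_j^{a−1}` for `j ∈ {0,1,2,3}`. [folklore] -/
theorem pderiv_pow_f (k : Type) [Field k] (a : ℕ) (f : MvPolynomial (Fin 5) k)
    (hf : f = X 4 ^ 2 + X 0 ^ a + X 1 ^ a + X 2 ^ a + X 3 ^ a) (j : Fin 5) (hj : j = 0 ∨ j = 1 ∨ j = 2 ∨ j = 3) :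
    pderiv j f = (a : MvPolynomial (Fin 5) k) * X j ^ (a - 1) := by
  rw [hf]
  rcases hj with rfl | rfl | rfl | rfl
  all_goals
    simp only [map_add, pderiv_pow, pderiv_X_self, pderiv_X_of_ne (show (4 : Fin 5) ≠ 0 by decide),
      pderiv_X_of_ne (show (1 : Fin 5) ≠ 0 by decide), pderiv_X_of_ne (show (2 : Fin 5) ≠ 0 by decide),
      pderiv_X_of_ne (show (3 : Fin 5) ≠ 0 by decide), pderiv_X_of_ne (show (4 : Fin 5) ≠ 1 by decide),
      pderiv_X_of_ne (show (0 : Fin 5) ≠ 1 by decide), pderiv_X_of_ne (show (2 : Fin 5) ≠ 1 by decide),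
      pderiv_X_of_ne (show (3 : Fin 5) ≠ 1 by decide), pderiv_X_of_ne (show (4 : Fin 5) ≠ 2 by decide),
      pderiv_X_of_ne (show (0 : Fin 5) ≠ 2 by decide), pderiv_X_of_ne (show (1 : Fin 5) ≠ 2 by decide),
      pderiv_X_of_ne (show (3 : Fin 5) ≠ 2 by decide), pderiv_X_of_ne (show (4 : Fin 5) ≠ 3 by decide),
      pderiv_X_of_ne (show (0 : Fin 5) ≠ 3 by decide), pderiv_X_of_ne (show (1 : Fin 5) ≠ 3 by decide),
      pderiv_X_of_ne (show (2 : Fin 5) ≠ 3 by decide), mul_zero, mul_one, zero_add, add_zero]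

/-- `f` has no constant term (`a ≠ 0`). [folklore] -/
theorem constantCoeff_f (k : Type) [Field k] (a : ℕ) (ha0 : a ≠ 0) (f : MvPolynomial (Fin 5) k)
    (hf : f = X 4 ^ 2 + X 0 ^ a + X 1 ^ a + X 2 ^ a + X 3 ^ a) : constantCoeff f = 0 := by
  rw [hf]
  simp [constantCoeff_X, zero_pow ha0]

/-- **`f = z² + x^a + y^a + u^a + t^a` is PRIME for `a` odd with `a ≠ 0` in `k`**: as `T² + C(0)·T + C(c)` over `k[x,y,u,t]` (`z ↦ T`), `c = x^a + y^a + u^a + t^a`, Eisenstein-type at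
the point `(1, −1, 0, 0)` where `c = 1 + (−1)^a = 0` and `∂c/∂x = a ≠ 0` (`irreducible_X_pow_add_C_mul_X_add_C`). [folklore] -/
theorem prime_f (k : Type) [Field k] (a : ℕ) (ha : Odd a) (haK : ((a : ℕ) : k) ≠ 0) (f : MvPolynomial (Fin 5) k)
    (hf : f = X 4 ^ 2 + X 0 ^ a + X 1 ^ a + X 2 ^ a + X 3 ^ a) : Prime f := by
  have ha0 : a ≠ 0 := fun h => by simp [h] at ha
  set e : MvPolynomial (Fin 5) k ≃+* Polynomial (MvPolynomial (Fin 4) k) :=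
    ((renameEquiv k (_root_.finRotate 5)).trans (finSuccEquiv k 4)).toRingEquiv with he_def
  have hrot4 : (_root_.finRotate 5) (4 : Fin 5) = 0 := by decide
  have hrot : ∀ j : Fin 4, (_root_.finRotate 5) (Fin.castSucc j) = j.succ := by decide
  have he4 : e (X 4) = Polynomial.X := by
    show finSuccEquiv k 4 (rename _ (X 4)) = _
    rw [rename_X, hrot4]; exact finSuccEquiv_X_zero
  have hej : ∀ j : Fin 4, e (X (Fin.castSucc j)) = Polynomial.C (X j) := fun j => by
    show finSuccEquiv k 4 (rename _ (X (Fin.castSucc j))) = _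
    rw [rename_X, hrot j]; exact finSuccEquiv_X_succ (j := j)
  set c : MvPolynomial (Fin 4) k := X 0 ^ a + X 1 ^ a + X 2 ^ a + X 3 ^ a with hc
  have hef : e f = Polynomial.X ^ 2 + Polynomial.C (0 : MvPolynomial (Fin 4) k) * Polynomial.X + Polynomial.C c := by
    rw [hf, map_add, map_add, map_add, map_add, map_pow, he4, map_pow, map_pow, map_pow, map_pow,
      show (0 : Fin 5) = Fin.castSucc (0 : Fin 4) from rfl, show (1 : Fin 5) = Fin.castSucc (1 : Fin 4) from rfl,
      show (2 : Fin 5) = Fin.castSucc (2 : Fin 4) from rfl, show (3 : Fin 5) = Fin.castSucc (3 : Fin 4) from rfl, hej, hej, hej, hej, hc]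
    simp only [map_add, map_pow, map_zero, zero_mul, add_zero]
    ring
  set q : Fin 4 → k := ![1, -1, 0, 0] with hq
  have hbq : MvPolynomial.eval q (0 : MvPolynomial (Fin 4) k) = 0 := map_zero _
  have hcq : MvPolynomial.eval q c = 0 := by
    rw [hc]
    simp only [map_add, map_pow, eval_X, hq, Matrix.cons_val_zero, Matrix.cons_val_one]
    simp only [Matrix.cons_val, one_pow, zero_pow ha0, add_zero, ha.neg_one_pow]
    ring
  have hder : MvPolynomial.eval q (pderiv 0 c) ≠ 0 := by
    have e1 : pderiv 0 c = (a : MvPolynomial (Fin 4) k) * X 0 ^ (a - 1) := by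
      rw [hc, map_add, map_add, map_add, pderiv_pow, pderiv_X_self, pderiv_pow, pderiv_X_of_ne (show (1 : Fin 4) ≠ 0 by decide),
        pderiv_pow, pderiv_X_of_ne (show (2 : Fin 4) ≠ 0 by decide), pderiv_pow, pderiv_X_of_ne (show (3 : Fin 4) ≠ 0 by decide)]
      simp only [mul_one, mul_zero, add_zero]
    rw [e1, map_mul, map_pow, eval_X, hq]
    simp only [Matrix.cons_val_zero, one_pow, mul_one, map_natCast]
    exact haK
  have hirr : Irreducible (e f) := by
    rw [hef]
    exact Literature.AlgebraicGeometry.Motives.SmoothHypersurface.irreducible_X_pow_add_C_mul_X_add_C (d := 2) le_rfl 0 c q hbq hcq 0 hder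
  exact (MulEquiv.prime_iff e).mp hirr.prime

/-- **`(k[X]/(f))_P` is regular at every prime `P ⊉ (x̄, ȳ, ū, t̄, z̄)`** when `2 ≠ 0` and `a ≠ 0` in `k`: some variable `X_j` misses `P`; then `∂f/∂X_j` (`= a·X_j^{a−1}` or `2z`)
misses `P` too (Jacobian criterion, `HypersurfaceRegular.stub_hypersurfaceRegularOfPderiv`). [cite: Hartshorne1977, I Thm. 5.1] -/
theorem regular_off_vertex (k : Type) [Field k] (a : ℕ) (h2 : (2 : k) ≠ 0) (haK : ((a : ℕ) : k) ≠ 0) (f : MvPolynomial (Fin 5) k)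
    (hf : f = X 4 ^ 2 + X 0 ^ a + X 1 ^ a + X 2 ^ a + X 3 ^ a)
    (P : Ideal (MvPolynomial (Fin 5) k ⧸ Ideal.span {f})) [P.IsPrime]
    (hP : ¬ Ideal.span (Set.range fun j : Fin 5 => Ideal.Quotient.mk (Ideal.span {f}) (X j)) ≤ P) :
    IsRegularLocalRing (Localization.AtPrime P) := by
  have hP' : (P.comap (Ideal.Quotient.mk (Ideal.span {f}))).IsPrime := Ideal.comap_isPrime _ _
  set P' := P.comap (Ideal.Quotient.mk (Ideal.span {f})) with hP'def
  have hex : ∃ j : Fin 5, (X j : MvPolynomial (Fin 5) k) ∉ P' := by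
    by_contra hall
    push Not at hall
    apply hP
    rw [Ideal.span_le]
    rintro _ ⟨j, rfl⟩
    exact hall j
  obtain ⟨j, hj⟩ := hex
  have hC2 : (C (2 : k) : MvPolynomial (Fin 5) k) ∉ P' := fun h =>
    hP'.ne_top ((Ideal.eq_top_iff_one _).mpr (by
      have hu : IsUnit (C (2 : k) : MvPolynomial (Fin 5) k) := (isUnit_iff_ne_zero.mpr h2).map C
      exact (Ideal.unit_mul_mem_iff_mem _ hu).mp (by simpa using h)))
  have hCa : (C ((a : ℕ) : k) : MvPolynomial (Fin 5) k) ∉ P' := fun h =>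
    hP'.ne_top ((Ideal.eq_top_iff_one _).mpr (by
      have hu : IsUnit (C ((a : ℕ) : k) : MvPolynomial (Fin 5) k) := (isUnit_iff_ne_zero.mpr haK).map C
      exact (Ideal.unit_mul_mem_iff_mem _ hu).mp (by simpa using h)))
  by_cases hj4 : j = 4
  · subst hj4
    refine HypersurfaceRegular.stub_hypersurfaceRegularOfPderiv k 5 f 4 P ?_
    rw [pderiv_four_f k a f hf, show (2 : MvPolynomial (Fin 5) k) = C (2 : k) from (map_ofNat C 2).symm]
    exact fun h => (hP'.mem_or_mem h).elim hC2 hj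
  · refine HypersurfaceRegular.stub_hypersurfaceRegularOfPderiv k 5 f j P ?_
    rw [pderiv_pow_f k a f hf j (eq_cube_index_of_ne_four j hj4), show ((a : ℕ) : MvPolynomial (Fin 5) k) = C ((a : ℕ) : k) from (map_natCast C a).symm]
    exact fun h => (hP'.mem_or_mem h).elim hCa fun h' => hj (hP'.mem_of_pow_mem (a - 1) h')

/-- `f ∉ (X i)` for every variable (`f(e_z) = 1`; `f(1,0,0,0,0) = 1`; `a ≠ 0`). [certificate] -/
theorem f_not_mem_span_X (k : Type) [Field k] (a : ℕ) (ha0 : a ≠ 0) (f : MvPolynomial (Fin 5) k)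
    (hf : f = X 4 ^ 2 + X 0 ^ a + X 1 ^ a + X 2 ^ a + X 3 ^ a) (i : Fin 5) :
    f ∉ Ideal.span {(X i : MvPolynomial (Fin 5) k)} := by
  intro h
  obtain ⟨c, hc⟩ := Ideal.mem_span_singleton.mp h
  by_cases hi : i = 4
  · subst hi
    have := congrArg (MvPolynomial.eval ![(1 : k), 0, 0, 0, 0]) hc
    rw [hf] at this
    simp [zero_pow ha0] at this
  · have := congrArg (MvPolynomial.eval (Pi.single 4 1 : Fin 5 → k)) hc
    rw [hf] at this
    simp [hi, zero_pow ha0] at this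

/-- No variable vanishes on `X`: `x̄_j ≠ 0` in `k[X]/(f)` (`a` odd, `a ≠ 0` in `k`). [folklore] -/
theorem mk_X_ne_zero (k : Type) [Field k] (a : ℕ) (ha : Odd a) (haK : ((a : ℕ) : k) ≠ 0) (f : MvPolynomial (Fin 5) k)
    (hf : f = X 4 ^ 2 + X 0 ^ a + X 1 ^ a + X 2 ^ a + X 3 ^ a) (j : Fin 5) :
    Ideal.Quotient.mk (Ideal.span {f}) (X j) ≠ 0 := fun h0 =>
  PrimeTransfer.X_not_mem_span_of_isPrime ((Ideal.span_singleton_prime (prime_f k a ha haK f hf).ne_zero).mpr (prime_f k a ha haK f hf))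
    (f_not_mem_span_X k a (fun h => by simp [h] at ha) f hf j) (Ideal.Quotient.eq_zero_iff_mem.mp h0)

/-- The vertex is NOT regular: `f(0) = 0`, `∇f(0) = 0` (`a ≥ 2` odd, `a ≠ 0` in `k`). [cite: Hartshorne1977, I Thm. 5.1] -/
theorem vertex_not_mem_regularLocus (k : Type) [Field k] (a : ℕ) (ha : Odd a) (ha2 : 2 ≤ a) (haK : ((a : ℕ) : k) ≠ 0) (f : MvPolynomial (Fin 5) k)
    (hf : f = X 4 ^ 2 + X 0 ^ a + X 1 ^ a + X 2 ^ a + X 3 ^ a)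
    (v : Spec (.of (MvPolynomial (Fin 5) k ⧸ Ideal.span {f})))
    (hv : v.asIdeal = Ideal.span (Set.range fun j : Fin 5 => Ideal.Quotient.mk (Ideal.span {f}) (X j))) :
    v ∉ Scheme.regularLocus (Spec (.of (MvPolynomial (Fin 5) k ⧸ Ideal.span {f}))) := by
  classical
  have ha0 : a ≠ 0 := by omega
  refine not_mem_regularLocus_Spec_of_not_isRegularLocalRing v ?_
  refine not_isRegularLocalRing_localization_of_pderiv_eval_eq_zero (0 : Fin 5 → k) (prime_f k a ha haK f hf).ne_zero ?_ ?_ v.asIdeal ?_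
  · rw [MvPolynomial.eval_zero]
    exact constantCoeff_f k a ha0 f hf
  · intro i
    by_cases hi4 : i = 4
    · subst hi4
      rw [pderiv_four_f k a f hf, map_mul, MvPolynomial.eval_X, Pi.zero_apply, mul_zero]
    · rw [pderiv_pow_f k a f hf i (eq_cube_index_of_ne_four i hi4), map_mul, map_pow, MvPolynomial.eval_X, Pi.zero_apply,
        zero_pow (by omega : a - 1 ≠ 0), mul_zero]
  · rw [hv, DoublePointFermatCubicGerm.comap_origin k f (constantCoeff_f k a ha0 f hf), MvPolynomial.eval_zero, Fedder.span_range_X_eq_ker]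

/-! ## §2 Support, convenience, weak non-degeneracy -/

/-- `f` as a sum of five monomials. [plumbing] -/
theorem eq_monomials (k : Type) [Field k] (a : ℕ) (f : MvPolynomial (Fin 5) k) (hf : f = X 4 ^ 2 + X 0 ^ a + X 1 ^ a + X 2 ^ a + X 3 ^ a) :
    f = monomial (Finsupp.single 4 2) 1 + monomial (Finsupp.single 0 a) 1 + monomial (Finsupp.single 1 a) 1 +
      monomial (Finsupp.single 2 a) 1 + monomial (Finsupp.single 3 a) 1 := by
  rw [hf]; simp only [X_pow_eq_monomial]

/-- The support of `f` consists of the five pure powers. [plumbing] -/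
theorem mem_support_f (k : Type) [Field k] (a : ℕ) (f : MvPolynomial (Fin 5) k) (hf : f = X 4 ^ 2 + X 0 ^ a + X 1 ^ a + X 2 ^ a + X 3 ^ a) :
    ∀ α ∈ f.support, α = Finsupp.single 4 2 ∨ α = Finsupp.single 0 a ∨ α = Finsupp.single 1 a ∨ α = Finsupp.single 2 a ∨ α = Finsupp.single 3 a := by
  classical
  intro α hα
  rw [eq_monomials k a f hf] at hα
  rcases mem_support_add5 hα with h | h | h | h | h
  · exact Or.inl (eq_of_mem_support_monomial h)
  · exact Or.inr (Or.inl (eq_of_mem_support_monomial h))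
  · exact Or.inr (Or.inr (Or.inl (eq_of_mem_support_monomial h)))
  · exact Or.inr (Or.inr (Or.inr (Or.inl (eq_of_mem_support_monomial h))))
  · exact Or.inr (Or.inr (Or.inr (Or.inr (eq_of_mem_support_monomial h))))

/-- ★ **`f` is CONVENIENT**: every variable occurs as a pure power with non-zero coefficient (`z²`, `x_j^a`; `a ≠ 0`, `a ≠ 2`) — the hypothesis of ✓ `F108ClassRow.F108Consumable`.
[folklore] -/
theorem convenient_f (k : Type) [Field k] (a : ℕ) (ha : Odd a) (f : MvPolynomial (Fin 5) k) (hf : f = X 4 ^ 2 + X 0 ^ a + X 1 ^ a + X 2 ^ a + X 3 ^ a) :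
    ∀ j : Fin 5, ∃ N : ℕ, 0 < N ∧ MvPolynomial.coeff (Finsupp.single j N) f ≠ 0 := by
  classical
  have ha0 : a ≠ 0 := fun h => by simp [h] at ha
  intro j
  rw [eq_monomials k a f hf]
  fin_cases j
  · exact ⟨a, Nat.pos_of_ne_zero ha0, by simp [coeff_monomial, Finsupp.single_eq_single_iff, ha0]⟩
  · exact ⟨a, Nat.pos_of_ne_zero ha0, by simp [coeff_monomial, Finsupp.single_eq_single_iff, ha0]⟩
  · exact ⟨a, Nat.pos_of_ne_zero ha0, by simp [coeff_monomial, Finsupp.single_eq_single_iff, ha0]⟩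
  · exact ⟨a, Nat.pos_of_ne_zero ha0, by simp [coeff_monomial, Finsupp.single_eq_single_iff, ha0]⟩
  · exact ⟨2, by norm_num, by simp [coeff_monomial, Finsupp.single_eq_single_iff]⟩

/-- ★ **`f = z² + x^a + y^a + u^a + t^a` IS WEAKLY NON-DEGENERATE ALONG EVERY POSITIVE WEIGHT** when `a ≠ 0` in `k` (`β₀ = 2e_z`, the possibly Jacobian-degenerate vertex;
good exponents `a·e_j`, `j < 4`: private variables with exponent `a ≢ 0`). One application of res-L1-w45a-stub-3's ✓ `weaklyNondegenerate_of_good_support`.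
[OURS · elementary certificate; cite: BoubakriGreuelMarkwig2010, §3 (p. 10)] -/
theorem weaklyNondegenerate_f (k : Type) [Field k] (a : ℕ) (haK : ((a : ℕ) : k) ≠ 0) (f : MvPolynomial (Fin 5) k)
    (hf : f = X 4 ^ 2 + X 0 ^ a + X 1 ^ a + X 2 ^ a + X 3 ^ a) :
    ∀ w : Fin 5 → ℝ, (∀ i, 0 < w i) → IsWeaklyNondegenerateAlong w (f : MvPowerSeries (Fin 5) k) := by
  classical
  have ha0 : a ≠ 0 := fun h => haK (by simp [h])
  have hf0 : f ≠ 0 := by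
    intro h0
    have := congrArg (MvPolynomial.eval (Pi.single 4 1 : Fin 5 → k)) h0
    rw [hf] at this
    simp [zero_pow ha0] at this
  have hsupp := mem_support_f k a f hf
  refine weaklyNondegenerate_of_good_support f hf0 (Finsupp.single 4 2) (fun α hα hne => ?_)
  rcases hsupp α hα with rfl | rfl | rfl | rfl | rfl
  · exact (hne rfl).elim
  · refine ⟨0, by simpa using haK, fun β hβ hβne => ?_⟩
    rcases hsupp β hβ with rfl | rfl | rfl | rfl | rfl
    · simp
    · exact (hβne rfl).elim
    · simp
    · simp
    · simp
  · refine ⟨1, by simpa using haK, fun β hβ hβne => ?_⟩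
    rcases hsupp β hβ with rfl | rfl | rfl | rfl | rfl
    · simp
    · simp
    · exact (hβne rfl).elim
    · simp
    · simp
  · refine ⟨2, by simpa using haK, fun β hβ hβne => ?_⟩
    rcases hsupp β hβ with rfl | rfl | rfl | rfl | rfl
    · simp
    · simp
    · simp
    · exact (hβne rfl).elim
    · simp
  · refine ⟨3, by simpa using haK, fun β hβ hβne => ?_⟩
    rcases hsupp β hβ with rfl | rfl | rfl | rfl | rfl
    · simp
    · simp
    · simp
    · simp
    · exact (hβne rfl).elim

end Summit.ResolutionOfSingularities.ResolutionOfSingularities.Theorems.FInjectiveMacaulayfication.DiagonalSqSpecimen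

end
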